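import Summits.Ventures.Crystal3D.Theorems.StickyWulffConstantNoReconstructionGainGrainGeom
import Summits.Ventures.Crystal3D.Theorems.StickyWulffConstantNoReconstructionGainGrainRim
import Summits.Ventures.Crystal3D.Theorems.StickyWulffConstantNoReconstructionGainLatticeAdhesion
import HarnessLib

/-!
# Cross contacts of the `(111)` slab sample are carried by the touchers of core sites

HONEST FRAMING. Part of the venture `Summits/Ventures/Crystal3D` (cell `crystal3d-full`), helper
`--supports` the crux `NoReconstructionGain` (stmt-Ventures-19144, route
`route-Ventures-StickyWulffConstant`), line `adhesion`, GRAIN RUNG.  Substrate-side bookkeeping,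
valid for an ARBITRARY overlayer (no grain hypothesis): with `P` the slab sample at `ν = e₃`
(`R = 4`, `ρ ≥ 4`) inside a unit packing `X`, the cross contacts split into those at RIM sites
(lateral radius `> ρ − 3`; at most `12 · 85πρ = 1020πρ` of them, kissing number twelve and
`card_rim_three_le`) and those at CORE sites, each of which is carried by a TOUCHER — a ball of
`X \ P` in the band `[−4h, −5h+1]` above the top face or `[−9h−1, −10h]` below the bottom face,
of lateral radius `≤ ρ − 2`, touching at most three sample sites (`…GrainGeom`).  Hence
`cross ≤ 3 (#Ta + #Tb) + 1020 π ρ` (`cross_le_touchers`).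

WHAT THIS IS NOT: any bound on the deficiency of the overlayer; rung F-C1 not moved.
-/

noncomputable section

namespace Summit.Ventures.Crystal3D.Theorems

open Summit.Ventures.Crystal3D Finset Real
open Literature.MathematicalPhysics.StatisticalMechanics (fccStacking orderedContacts
  contactDeficiency)
open scoped InnerProductSpace

/-- **Cross contacts are carried by touchers.**  `P` the slab sample (coordinate form, `ρ ≥ 4`)
inside a unit packing `X`: there are sets `Ta, Tb ⊆ X \ P` of above- and below-touchers (height bands
`[−4h, −5h+1]`, `[−9h−1, −10h]`, lateral radius `≤ ρ − 2`, `h = √(2/3)`) with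
`#{(p, q) ∈ P × (X \ P) : dist p q = 1} ≤ 3 (#Ta + #Tb) + 1020 π ρ`. -/
theorem cross_le_touchers (ρ : ℝ) (hρ : 4 ≤ ρ) (X P : Finset (EuclideanSpace ℝ (Fin 3)))
    (hX : ∀ p ∈ X, ∀ q ∈ X, p ≠ q → 1 ≤ dist p q) (hPX : P ⊆ X)
    (hP' : ∀ p, p ∈ P ↔ (p ∈ fccStacking 1 (Real.sqrt (2 / 3)) ∧ -8 ≤ p 2 ∧ p 2 ≤ -4 ∧
      p 0 ^ 2 + p 1 ^ 2 ≤ ρ ^ 2)) :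
    ∃ Ta Tb : Finset (EuclideanSpace ℝ (Fin 3)), Ta ⊆ X \ P ∧ Tb ⊆ X \ P ∧
      (∀ q ∈ Ta, -(4 * Real.sqrt (2 / 3)) ≤ q 2 ∧ q 2 ≤ -(5 * Real.sqrt (2 / 3)) + 1 ∧
        q 0 ^ 2 + q 1 ^ 2 ≤ (ρ - 2) ^ 2) ∧
      (∀ q ∈ Tb, -(9 * Real.sqrt (2 / 3)) - 1 ≤ q 2 ∧ q 2 ≤ -(10 * Real.sqrt (2 / 3)) ∧
        q 0 ^ 2 + q 1 ^ 2 ≤ (ρ - 2) ^ 2) ∧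
      ((((P ×ˢ (X \ P)).filter fun pq => dist pq.1 pq.2 = 1).card : ℕ) : ℝ) ≤
        3 * ((Ta.card : ℝ) + Tb.card) + 1020 * Real.pi * ρ := by
  classical
  obtain ⟨hh2, hh45, hh89⟩ := sqrt_two_thirds_bounds
  set h : ℝ := Real.sqrt (2 / 3) with hhdef
  -- the slab potential
  set Φ : EuclideanSpace ℝ (Fin 3) → ℝ := fun y => max (y 2 + 5 * h) (max (-(9 * h) - y 2) 0)
    with hΦdef
  have hΦ : ∀ y, Φ y = max (y 2 + 5 * h) (max (-(9 * h) - y 2) 0) := fun y => rfl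
  have hΦP : ∀ p ∈ P, Φ p = 0 := by
    intro p hp
    obtain ⟨hΛ, h1, h2, -⟩ := (hP' p).1 hp
    obtain ⟨hz1, hz2⟩ := slab_height_bounds hΛ h1 h2
    rw [hΦ, max_eq_right (le_trans (by linarith) (le_max_right _ _)), max_eq_right (by linarith)]
  set Q := X \ P with hQ
  have hQX : ∀ q ∈ Q, q ∈ X ∧ q ∉ P := fun q hq => mem_sdiff.1 hq
  /- ### 4. Touchers of core sites -/
  set core := P.filter fun p => p 0 ^ 2 + p 1 ^ 2 ≤ (ρ - 3) ^ 2 with hcore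
  set rim := P.filter fun p => (ρ - 3) ^ 2 < p 0 ^ 2 + p 1 ^ 2 with hrim
  have hrimle : (rim.card : ℝ) ≤ 85 * Real.pi * ρ := card_rim_three_le ρ hρ P hP'
  set Tch := Q.filter fun q => ∃ p ∈ core, dist q p = 1 with hTch
  have hTch : ∀ q ∈ Tch, q ∈ X ∧ q ∉ P ∧ h ≤ Φ q ∧ q 0 ^ 2 + q 1 ^ 2 ≤ (ρ - 2) ^ 2 ∧
      ((-(4 * h) ≤ q 2 ∧ q 2 ≤ -(5 * h) + 1) ∨ (-(9 * h) - 1 ≤ q 2 ∧ q 2 ≤ -(10 * h))) := by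
    intro q hq
    rw [hTch, mem_filter] at hq
    obtain ⟨hqQ, p, hp, hqp⟩ := hq
    rw [hcore, mem_filter] at hp
    obtain ⟨hpP, hpcore⟩ := hp
    have hqX := (hQX q hqQ).1
    have hqP := (hQX q hqQ).2
    have hpq : dist p q = 1 := by rw [dist_comm]; exact hqp
    have hΦq := le_slabPotential_of_touch_core ρ hρ X P hX hPX hP' Φ hΦ p q hqX hqP hpcore hpq
    have hlatq : q 0 ^ 2 + q 1 ^ 2 ≤ (ρ - 3 + 1) ^ 2 :=
      lateral_sq_le_of_dist_le_one (by linarith) hpcore hqp.le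
    rw [show ρ - 3 + 1 = ρ - 2 by ring] at hlatq
    obtain ⟨hΛ, h1, h2, -⟩ := (hP' p).1 hpP
    obtain ⟨hz1, hz2⟩ := slab_height_bounds hΛ h1 h2
    exact ⟨hqX, hqP, hΦq, hlatq, toucher_dichotomy Φ hΦ p q hz1 hz2 hpq hΦq⟩
  -- cross ≤ 3 #Tch + 12 #rim
  have hcross : ((((P ×ˢ Q).filter fun pq => dist pq.1 pq.2 = 1).card : ℕ) : ℝ) ≤
      3 * (Tch.card : ℝ) + 12 * (rim.card : ℝ) := by
    rw [card_crossContacts_eq_sum_sum]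
    -- split `P = core ∪ rim`
    have hsplitP : ∀ q, (∑ p ∈ P, if dist p q = 1 then (1 : ℝ) else 0) =
        (∑ p ∈ core, if dist p q = 1 then (1 : ℝ) else 0) +
          ∑ p ∈ rim, if dist p q = 1 then (1 : ℝ) else 0 := by
      intro q
      rw [hcore, hrim, ← sum_filter_add_sum_filter_not P (fun p => p 0 ^ 2 + p 1 ^ 2 ≤ (ρ - 3) ^ 2)]
      congr 1
      refine sum_congr (filter_congr fun p _ => by simp [not_le]) fun _ _ => rfl
    rw [sum_comm]
    have hrimpart : ∑ q ∈ Q, ∑ p ∈ rim, (if dist p q = 1 then (1 : ℝ) else 0) ≤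
        12 * (rim.card : ℝ) := by
      rw [sum_comm]
      have hle : ∀ p ∈ rim, ∑ q ∈ Q, (if dist p q = 1 then (1 : ℝ) else 0) ≤ 12 := by
        intro p hp
        rw [Finset.sum_boole]
        calc (((Q.filter fun q => dist p q = 1).card : ℕ) : ℝ)
            ≤ ((X.filter fun q => dist p q = 1).card : ℝ) := by
              exact_mod_cast card_le_card (filter_subset_filter _ (by rw [hQ]; exact sdiff_subset))
          _ ≤ 12 := by exact_mod_cast card_partners_le_twelve X hX p
      calc ∑ p ∈ rim, ∑ q ∈ Q, (if dist p q = 1 then (1 : ℝ) else 0)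
          ≤ ∑ _p ∈ rim, (12 : ℝ) := sum_le_sum hle
        _ = 12 * (rim.card : ℝ) := by rw [sum_const, nsmul_eq_mul, mul_comm]
    have hcorepart : ∑ q ∈ Q, ∑ p ∈ core, (if dist p q = 1 then (1 : ℝ) else 0) ≤
        3 * (Tch.card : ℝ) := by
      rw [← sum_filter_add_sum_filter_not Q (fun q => ∃ p ∈ core, dist q p = 1)]
      have hzero : ∑ q ∈ Q.filter (fun q => ¬ ∃ p ∈ core, dist q p = 1),
          ∑ p ∈ core, (if dist p q = 1 then (1 : ℝ) else 0) = 0 := by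
        refine sum_eq_zero fun q hq => sum_eq_zero fun p hp => ?_
        rw [mem_filter] at hq
        rw [if_neg]
        intro hpq
        exact hq.2 ⟨p, hp, by rw [dist_comm]; exact hpq⟩
      rw [hzero, add_zero]
      have hle : ∀ q ∈ Tch, ∑ p ∈ core, (if dist p q = 1 then (1 : ℝ) else 0) ≤ 3 := by
        intro q hq
        obtain ⟨-, -, hΦq, -, -⟩ := hTch q hq
        rw [Finset.sum_boole]
        calc (((core.filter fun p => dist p q = 1).card : ℕ) : ℝ)
            ≤ ((P.filter fun p => dist q p = 1).card : ℝ) := by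
              refine Nat.cast_le.2 (card_le_card fun p hp => ?_)
              rw [mem_filter] at hp ⊢
              exact ⟨(mem_filter.1 hp.1).1, by rw [dist_comm]; exact hp.2⟩
          _ ≤ 3 := by exact_mod_cast card_samplePartners_le_three X P hX hPX Φ hΦ hΦP q hΦq
      calc ∑ q ∈ Tch, ∑ p ∈ core, (if dist p q = 1 then (1 : ℝ) else 0)
          ≤ ∑ _q ∈ Tch, (3 : ℝ) := sum_le_sum hle
        _ = 3 * (Tch.card : ℝ) := by rw [sum_const, nsmul_eq_mul, mul_comm]
    calc ∑ q ∈ Q, ∑ p ∈ P, (if dist p q = 1 then (1 : ℝ) else 0)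
        = (∑ q ∈ Q, ∑ p ∈ core, (if dist p q = 1 then (1 : ℝ) else 0)) +
            ∑ q ∈ Q, ∑ p ∈ rim, (if dist p q = 1 then (1 : ℝ) else 0) := by
          rw [← sum_add_distrib]; exact sum_congr rfl fun q _ => hsplitP q
      _ ≤ 3 * (Tch.card : ℝ) + 12 * (rim.card : ℝ) := by linarith
  /- ### 5. Touchers above / below, pulled back to sites -/
  set Ta := Tch.filter fun q => -(4 * h) ≤ q 2 with hTa
  set Tb := Tch.filter fun q => ¬ -(4 * h) ≤ q 2 with hTb
  have hTab : Tch.card = Ta.card + Tb.card := by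
    rw [hTa, hTb]; exact (card_filter_add_card_filter_not _).symm
  have hTaQ : Ta ⊆ Q := fun q hq => (mem_filter.1 (mem_filter.1 hq).1).1
  have hTbQ : Tb ⊆ Q := fun q hq => (mem_filter.1 (mem_filter.1 hq).1).1
  refine ⟨Ta, Tb, hTaQ, hTbQ, ?_, ?_, ?_⟩
  · intro q hq
    rw [hTa, mem_filter] at hq
    obtain ⟨-, -, -, hlatq, hband⟩ := hTch _ hq.1
    rcases hband with ⟨h1, h2⟩ | ⟨h1, h2⟩
    · exact ⟨h1, h2, hlatq⟩
    · exfalso; linarith [hq.2]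
  · intro q hq
    rw [hTb, mem_filter] at hq
    obtain ⟨-, -, -, hlatq, hband⟩ := hTch _ hq.1
    rcases hband with ⟨h1, h2⟩ | ⟨h1, h2⟩
    · exfalso; exact hq.2 h1
    · exact ⟨h1, h2, hlatq⟩
  · have hT : (Tch.card : ℝ) = (Ta.card : ℝ) + Tb.card := by rw [hTab]; push_cast; ring
    rw [hT] at hcross
    nlinarith [hcross, hrimle, Real.pi_pos]

end Summit.Ventures.Crystal3D.Theorems

end
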